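import Summits.BirchSwinnertonDyer.BirchSwinnertonDyer.Theorems.ManinLocalTwoThreeConwayNortonTwistPairs
import Summits.BirchSwinnertonDyer.BirchSwinnertonDyer.Theorems.ManinLocalTwoThreeAtkinLehnerEpsConj
import Summits.BirchSwinnertonDyer.BirchSwinnertonDyer.Theorems.ManinLocalTwoThreeConwayDefectTransfer
import Summits.BirchSwinnertonDyer.BirchSwinnertonDyer.Theorems.ManinLocalTwoThreeTranslationNewform
import HarnessLib

/-!
# `M^G ≤ S^R ⊗ ℤ[ζ₃]`, and the UPPER HALF of E-desc-56: `planeIndex(M^G, f) ∣ r_R(f)²`, `k(f) ≤ 2·ord₃ r_R(f)`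

Summit `BirchSwinnertonDyer`, sub-problem `BirchSwinnertonDyer`, route `ManinLocalTwoThree`; width seat `bsd-line-manin23-p2`
(gen 9), `--supports` the crux C3 `ManinPrimeToThreeAtNine` (stmt-BirchSwinnertonDyer-22968).  Cell `bsd-f2-manin`, descent
lens desc g8 MEMO-desc §25: the Conway–Norton lattice `M^G(N) = conwayNortonLatticeAtThree N` (largest `ℤ[ζ₃]`-lattice in
`S ⊗ ℤ[ζ₃]` stable under `w_Q`, `t_{1/3}`) and the Ramanujan lattice `S^R(N) = ramanujanStableLattice N` (largest sublattice of
`S = S₂(Γ₀(N);ℤ)` stable under `w_Q`, `R₃ = t_{1/3} + t_{2/3}`).  desc's row E-desc-56 `EisensteinHalfStepBound` reads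
`2 ord₃ r_R(f) − 1 ≤ k(f) ≤ 2 ord₃ r_R(f)` (140/140) with the remark «neither bound is formal: `M^G` need not be comparable
with `S^R ⊗ ℤ[ζ₃]`».  THIS FILE PROVES THE COMPARISON `M^G ≤ S^R ⊗ ℤ[ζ₃]` AT EVERY LEVEL `9 ∣ N`, whence the UPPER bound is
formal for every `f ∈ M^G` (e.g. both newforms of a same-conductor `χ₋₃`-twist pair): `planeIndex(M^G, f) ∣ r_R(f)²`
(`f ∈ S^R` is not even needed: the tree's `exists_int_lineIndex_mul_petersson_eq` bounds `r_R · ⟨f, S^R⟩` for any `f`).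

PROVED here (sorry-free):

* `eq_of_add_zeta3_smul_eq` — uniqueness of the coordinates `u + ζ₃ u'` for `ε`-fixed (real-coefficient) forms;
* `ramanujanThree_eq_add_thirdTranslate`, `ramanujanThree_mem_integralCuspForms0`, `ramanujanThree_mem_conwayNorton`;
* **`conwayNortonLatticeAtThree_le_eisensteinSpan_ramanujan`** (`9 ∣ N`): `M^G ≤ S^R + ζ₃ S^R`.  Proof: the coordinate
  lattice `P = {s ∈ S : ∃ s' ∈ S, s + ζ₃ s' ∈ M^G}` is integral, `R₃`-stable and — the one analytic input — `w_Q`-stable,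
  because `w_Q` maps integral forms to REAL-coefficient forms (`(w_Q f)^ε = w_Q f^ε`, sibling file
  `ManinLocalTwoThreeAtkinLehnerEpsConj`) and real coordinates are unique; so `P ≤ S^R` by maximality, and both coordinates
  of every `m ∈ M^G` lie in `P` (`ζ₃ m = −s' + ζ₃(s − s')`);
* **`planeIndex_conwayNorton_dvd_sq_lineIndex_ramanujan`** (`9 ∣ N`, `f ∈ M^G`): `planeIndex(M^G, f) ∣ r_R(f)²`
  (`⟨f, M^G⟩ ⊆ r⁻¹(ℤc + ℤζ₃c)`, `c = ⟨f,f⟩`, by the tree's `exists_int_lineIndex_mul_petersson_eq`, and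
  `[r⁻¹Λ : Λ] ∣ r²` via `(ℤ/r)² ↠ r⁻¹Λ/Λ`);
* **`eisensteinDepth_conwayNorton_le`** — hence `k(f) ≤ 2 · ord₃ r_R(f)` whenever `f ∈ M^G` and `r_R(f) ≠ 0`: the UPPER HALF of E-desc-56 on
  its census locus (the typed row quantifies over optimal data without the `r_R ≠ 0` guard; at `r_R = 0`, junk, it reads
  `k = 0`, which this method does not give);
* `eisensteinDepth_le_of_isIsogenous_quadraticTwist_negThree` — the E-facing instance for same-conductor `(−3)`-twist pairs
  of elliptic curves (`f ∈ M^G` by P-desc-2).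

Elementary.  BSD is not proved by this; Manin's conjecture is not proved by this; C3 is not closed by this.
-/

set_option autoImplicit false
set_option linter.dupNamespace false

noncomputable section

open scoped MatrixGroups ModularForm ComplexConjugate
open CongruenceSubgroup WeierstrassCurve
open Literature.NumberTheory.EllipticCurves Literature.NumberTheory.EllipticCurves.ModularForms
open Summit.BirchSwinnertonDyer.Rank1Residual.ManinAdditive
open Summit.BirchSwinnertonDyer.Rank1Residual.ManinAdditive.RamanujanCut
open Summit.BirchSwinnertonDyer.Rank1Residual.ManinAdditive.ConwayNortonThree

namespace Summit.BirchSwinnertonDyer.BirchSwinnertonDyer.Theorems.ManinLocalTwoThree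

variable {N : ℕ} [NeZero N]

/-! ### Real coordinates in `S ⊗ ℤ[ζ₃]` are unique -/

/-- **Uniqueness of coordinates**: if `u + ζ₃ u' = v + ζ₃ v'` with `u, u', v, v'` all `ε`-fixed (real Fourier
coefficients), then `u = v` and `u' = v'` (`{1, ζ₃}` is `ℝ`-free, coefficientwise). -/
theorem eq_of_add_zeta3_smul_eq {u u' v v' : CuspForm (Gamma0 N) 2} (hu : epsConj0 u = u) (hu' : epsConj0 u' = u')
    (hv : epsConj0 v = v) (hv' : epsConj0 v' = v') (h : u + zeta3 • u' = v + zeta3 • v') : u = v ∧ u' = v' := by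
  rw [epsConj0_eq_self_iff] at hu hu' hv hv'
  have key : ∀ n, cuspCoeff u n = cuspCoeff v n ∧ cuspCoeff u' n = cuspCoeff v' n := by
    intro n
    have hn := congrArg (fun t : CuspForm (Gamma0 N) 2 => cuspCoeff t n) h
    simp only [cuspCoeff_add_gamma0, cuspCoeff_smul_gamma0] at hn
    have ru := Complex.conj_eq_iff_re.mp (hu n)
    have ru' := Complex.conj_eq_iff_re.mp (hu' n)
    have rv := Complex.conj_eq_iff_re.mp (hv n)
    have rv' := Complex.conj_eq_iff_re.mp (hv' n)
    have h0 : (((cuspCoeff u n).re - (cuspCoeff v n).re : ℝ) : ℂ) +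
        (((cuspCoeff u' n).re - (cuspCoeff v' n).re : ℝ) : ℂ) * zeta3 = 0 := by
      push_cast
      rw [ru, ru', rv, rv']
      linear_combination hn
    obtain ⟨h1, h2⟩ := eq_zero_of_add_mul_zeta3_eq_zero h0
    constructor
    · rw [← ru, ← rv]; exact_mod_cast (sub_eq_zero.mp h1)
    · rw [← ru', ← rv']; exact_mod_cast (sub_eq_zero.mp h2)
  exact ⟨eq_of_forall_cuspCoeff_eq_gamma0 fun n => (key n).1, eq_of_forall_cuspCoeff_eq_gamma0 fun n => (key n).2⟩

/-! ### The Ramanujan endomorphism `R₃ = t_{1/3} + t_{2/3}` -/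

/-- `R₃ = t_{1/3} + t_{2/3}` (definitional bookkeeping of the two typed operators). -/
theorem ramanujanThree_eq_add_thirdTranslate (k : ℤ) (x : CuspForm (Gamma0 N) k) :
    ramanujanThree N k x = thirdTranslate N k 1 x + thirdTranslate N k 2 x := by
  simp only [ramanujanThree, thirdTranslate, LinearMap.smul_apply, LinearMap.add_apply, smul_add]

/-- `ζ₃ⁿ + ζ₃²ⁿ` is the integer `2` or `−1`. -/
theorem exists_int_zeta3_pow_add (n : ℕ) : ∃ z : ℤ, (z : ℂ) = (zeta3 ^ 1) ^ n + (zeta3 ^ 2) ^ n := by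
  have h3 : zeta3 ^ 3 = 1 := isPrimitiveRoot_zeta3.pow_eq_one
  have hmod : zeta3 ^ n = zeta3 ^ (n % 3) := by
    conv_lhs => rw [← Nat.div_add_mod n 3, pow_add, pow_mul, h3, one_pow, one_mul]
  rw [pow_one, ← pow_mul, show 2 * n = n + n from two_mul n, pow_add, hmod]
  have hr : n % 3 = 0 ∨ n % 3 = 1 ∨ n % 3 = 2 := by omega
  rcases hr with hr | hr | hr <;> rw [hr]
  · exact ⟨2, by norm_num⟩
  · exact ⟨-1, by push_cast; linear_combination (-1 : ℂ) * one_add_zeta3_add_sq⟩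
  · exact ⟨-1, by push_cast; linear_combination (-1 : ℂ) * one_add_zeta3_add_sq + (-zeta3) * h3⟩

/-- **`R₃` preserves `S₂(Γ₀(N); ℤ)`** (`9 ∣ N`): `aₙ(R₃ s) = (ζ₃ⁿ + ζ₃²ⁿ) aₙ(s)` with `ζ₃ⁿ + ζ₃²ⁿ ∈ {2, −1}`. -/
theorem ramanujanThree_mem_integralCuspForms0 (h9 : 9 ∣ N) {s : CuspForm (Gamma0 N) 2}
    (hs : s ∈ integralCuspForms0 N 2) : ramanujanThree N 2 s ∈ integralCuspForms0 N 2 := by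
  intro n
  obtain ⟨a, ha⟩ := hs n
  obtain ⟨z, hz⟩ := exists_int_zeta3_pow_add n
  refine ⟨z * a, ?_⟩
  rw [ramanujanThree_eq_add_thirdTranslate, cuspCoeff_add_gamma0, cuspCoeff_thirdTranslate_two h9,
    cuspCoeff_thirdTranslate_two h9, Int.cast_mul, hz, ha]
  ring

/-- **`R₃` preserves `M^G`** (`9 ∣ N`): `R₃ = t_{1/3} + t_{1/3}²`. -/
theorem ramanujanThree_mem_conwayNorton (h9 : 9 ∣ N) {x : CuspForm (Gamma0 N) 2}
    (hx : x ∈ conwayNortonLatticeAtThree N) : ramanujanThree N 2 x ∈ conwayNortonLatticeAtThree N := by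
  rw [ramanujanThree_eq_add_thirdTranslate, thirdTranslate_two_eq_comp h9, LinearMap.comp_apply]
  exact Submodule.add_mem _ (thirdTranslate_one_mem_conwayNortonLatticeAtThree hx)
    (thirdTranslate_one_mem_conwayNortonLatticeAtThree (thirdTranslate_one_mem_conwayNortonLatticeAtThree hx))

omit [NeZero N] in
/-- `eisensteinSpan` is monotone. -/
theorem eisensteinSpan_mono {L L' : Submodule ℤ (CuspForm (Gamma0 N) 2)} (h : L ≤ L') :
    eisensteinSpan L ≤ eisensteinSpan L' :=
  sup_le_sup h (Submodule.map_mono h)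

/-! ### `M^G ≤ S^R ⊗ ℤ[ζ₃]` -/

/-- **`M^G(N) ≤ S^R(N) + ζ₃ S^R(N)` for `9 ∣ N`** — the Conway–Norton lattice IS comparable with the Ramanujan lattice
tensored with `ℤ[ζ₃]` (contrary to the caveat in desc's E-desc-56 docstring).  See the module docstring for the proof. -/
theorem conwayNortonLatticeAtThree_le_eisensteinSpan_ramanujan (h9 : 9 ∣ N) :
    conwayNortonLatticeAtThree N ≤ eisensteinSpan (ramanujanStableLattice N) := by
  set S := integralCuspForms0 N 2 with hSdef
  set M := conwayNortonLatticeAtThree N with hMdef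
  -- the coordinate lattice
  let P : Submodule ℤ (CuspForm (Gamma0 N) 2) :=
    { carrier := {s | s ∈ S ∧ ∃ s' ∈ S, s + zeta3 • s' ∈ M}
      add_mem' := by
        rintro a b ⟨haS, a', ha'S, ha⟩ ⟨hbS, b', hb'S, hb⟩
        refine ⟨S.add_mem haS hbS, a' + b', S.add_mem ha'S hb'S, ?_⟩
        have : a + b + zeta3 • (a' + b') = (a + zeta3 • a') + (b + zeta3 • b') := by rw [smul_add]; abel
        rw [this]
        exact M.add_mem ha hb
      zero_mem' := ⟨S.zero_mem, 0, S.zero_mem, by rw [smul_zero, add_zero]; exact M.zero_mem⟩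
      smul_mem' := by
        rintro c a ⟨haS, a', ha'S, ha⟩
        refine ⟨S.smul_mem c haS, c • a', S.smul_mem c ha'S, ?_⟩
        have : c • a + zeta3 • (c • a') = c • (a + zeta3 • a') := by rw [smul_comm zeta3 c a', smul_add]
        rw [this]
        exact M.smul_mem c ha }
  have hPmem : ∀ {s : CuspForm (Gamma0 N) 2}, s ∈ P ↔ s ∈ S ∧ ∃ s' ∈ S, s + zeta3 • s' ∈ M := fun {s} => Iff.rfl
  -- `P ≤ S^R`
  have hPR : P ≤ ramanujanStableLattice N := by
    refine le_sSup ⟨fun s hs => (hPmem.mp hs).1, ?_, ?_⟩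
    · -- `w_Q`-stability: `w s`, `w s'` have real coefficients, and real coordinates are unique
      rintro q hq hqN _ ⟨s, hs, rfl⟩
      obtain ⟨hsS, s', hs'S, hm⟩ := hPmem.mp hs
      change atkinLehnerInvolutionAt N 2 q s ∈ P
      have hwm : atkinLehnerInvolutionAt N 2 q s + zeta3 • atkinLehnerInvolutionAt N 2 q s' ∈ M := by
        have := atkinLehnerInvolutionAt_mem_conwayNortonLatticeAtThree hq hqN hm
        rwa [map_add, map_smul] at this
      obtain ⟨u, hu, w, hw, huw⟩ := Submodule.mem_sup.mp (conwayNortonLatticeAtThree_le hwm)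
      obtain ⟨u', hu', rfl⟩ := Submodule.mem_map.mp hw
      have hεs := epsConj0_atkinLehnerInvolutionAt_eq_self hq hqN (epsConj0_eq_self_of_mem_integralCuspForms0 hsS)
      have hεs' := epsConj0_atkinLehnerInvolutionAt_eq_self hq hqN (epsConj0_eq_self_of_mem_integralCuspForms0 hs'S)
      obtain ⟨h1, h2⟩ := eq_of_add_zeta3_smul_eq hεs hεs' (epsConj0_eq_self_of_mem_integralCuspForms0 hu)
        (epsConj0_eq_self_of_mem_integralCuspForms0 hu') huw.symm
      refine hPmem.mpr ⟨h1 ▸ hu, atkinLehnerInvolutionAt N 2 q s', h2 ▸ hu', hwm⟩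
    · -- `R₃`-stability
      rintro _ ⟨s, hs, rfl⟩
      obtain ⟨hsS, s', hs'S, hm⟩ := hPmem.mp hs
      change ramanujanThree N 2 s ∈ P
      refine hPmem.mpr ⟨ramanujanThree_mem_integralCuspForms0 h9 hsS, ramanujanThree N 2 s',
        ramanujanThree_mem_integralCuspForms0 h9 hs'S, ?_⟩
      have := ramanujanThree_mem_conwayNorton h9 hm
      rwa [map_add, map_smul] at this
  -- both coordinates of `m ∈ M` lie in `P`
  intro m hm
  obtain ⟨s, hs, w, hw, hsw⟩ := Submodule.mem_sup.mp (conwayNortonLatticeAtThree_le hm)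
  obtain ⟨s', hs', rfl⟩ := Submodule.mem_map.mp hw
  change s + zeta3 • s' = m at hsw
  have hsP : s ∈ P := hPmem.mpr ⟨hs, s', hs', hsw ▸ hm⟩
  have hs'P : s' ∈ P := by
    have hneg : -s' ∈ P := by
      refine hPmem.mpr ⟨S.neg_mem hs', s - s', S.sub_mem hs hs', ?_⟩
      have h := zeta3_smul_mem_conwayNortonLatticeAtThree (hsw ▸ hm : s + zeta3 • s' ∈ M)
      have e : zeta3 • (s + zeta3 • s') = -s' + zeta3 • (s - s') := by
        rw [smul_add, smul_smul, ← sq, zeta3_sq, sub_smul, neg_smul, one_smul, smul_sub]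
        abel
      rwa [e] at h
    simpa using P.neg_mem hneg
  rw [← hsw]
  exact Submodule.add_mem _ (Submodule.mem_sup_left (hPR hsP)) (Submodule.mem_sup_right ⟨s', hPR hs'P, rfl⟩)

/-! ### The upper half of E-desc-56 -/

/-- **`planeIndex(M^G, f) ∣ r_R(f)²`** (`9 ∣ N`, `f ∈ M^G`; `r_R(f) = lineIndex (S^R) f`, `0` if infinite — then trivial).  With `L = ⟨f, ·⟩`, `c = ⟨f,f⟩`, `Λ = ℤc + ℤζ₃c = L(M^G ∩ (ℤf + ℤζ₃f))`: `planeIndex = [L(M^G) : Λ]`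
(`planeIndex_eq_relIndex`); `L(M^G) ⊆ L(S^R) + ζ₃ L(S^R) ⊆ Λ_r = {x : r x ∈ Λ}` (`M^G ≤ S^R ⊗ ℤ[ζ₃]` and
`r ⟨f, S^R⟩ ⊆ ℤ c`); and `[Λ_r : Λ] ∣ r²` because `(ℤ/r)² ↠ Λ_r/Λ`, `(i, j) ↦ (i c + j ζ₃ c)/r`. -/
theorem planeIndex_conwayNorton_dvd_sq_lineIndex_ramanujan (h9 : 9 ∣ N) {f : CuspForm (Gamma0 N) 2}
    (hfM : f ∈ conwayNortonLatticeAtThree N) :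
    planeIndex (conwayNortonLatticeAtThree N) f ∣ (lineIndex (ramanujanStableLattice N) f) ^ 2 := by
  set r := lineIndex (ramanujanStableLattice N) f with hrdef
  rcases Nat.eq_zero_or_pos r with hr0 | hrpos
  · rw [hr0]; simp
  set M := conwayNortonLatticeAtThree N with hMdef
  set c : ℂ := peterssonProduct (Gamma0 N) 2 f f with hcdef
  set Lf := (peterssonProductₗ (Gamma0 N) 2 f).toAddMonoidHom with hLf
  set A : AddSubgroup ℂ := M.toAddSubgroup.map Lf with hAdef
  set Λ : AddSubgroup ℂ := AddSubgroup.closure {c, zeta3 * c} with hΛdef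
  -- `P_f ≤ M`
  have hPf : (ℤ ∙ f) ⊔ (ℤ ∙ (zeta3 • f)) ≤ M :=
    sup_le ((Submodule.span_singleton_le_iff_mem _ _).mpr hfM)
      ((Submodule.span_singleton_le_iff_mem _ _).mpr (zeta3_smul_mem_conwayNortonLatticeAtThree hfM))
  have hplane : planeIndex M f = Λ.relIndex A := by
    rw [planeIndex_eq_relIndex, map_inf_eq_closure_of_le hPf]
  -- `Λ_r = {x : r x ∈ Λ}`
  set Λr : AddSubgroup ℂ := Λ.comap (AddMonoidHom.mulLeft (r : ℂ)) with hΛrdef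
  have hc_mem : c ∈ Λ := AddSubgroup.subset_closure (by simp)
  have hζc_mem : zeta3 * c ∈ Λ := AddSubgroup.subset_closure (by simp)
  have hΛA : Λ ≤ A := by
    rw [hΛdef, AddSubgroup.closure_le]
    rintro z hz
    simp only [Set.mem_insert_iff, Set.mem_singleton_iff] at hz
    rcases hz with rfl | rfl
    · exact ⟨f, hfM, rfl⟩
    · refine ⟨zeta3 • f, zeta3_smul_mem_conwayNortonLatticeAtThree hfM, ?_⟩
      change peterssonProduct (Gamma0 N) 2 f (zeta3 • f) = zeta3 * c
      rw [peterssonProduct_smul_right]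
  -- `A ≤ Λ_r`: `r ⟨f, m⟩ ∈ ℤc + ζ₃ ℤc` for `m ∈ M ≤ S^R + ζ₃ S^R`
  have hAΛr : A ≤ Λr := by
    rintro _ ⟨m, hm, rfl⟩
    rw [AddSubgroup.mem_comap, AddMonoidHom.coe_mulLeft]
    change (r : ℂ) * peterssonProduct (Gamma0 N) 2 f m ∈ Λ
    obtain ⟨s, hs, w, hw, hsw⟩ :=
      Submodule.mem_sup.mp (conwayNortonLatticeAtThree_le_eisensteinSpan_ramanujan h9 hm)
    obtain ⟨s', hs', rfl⟩ := Submodule.mem_map.mp hw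
    change s + zeta3 • s' = m at hsw
    obtain ⟨n, hn⟩ := exists_int_lineIndex_mul_petersson_eq (ramanujanStableLattice N) f hs
    obtain ⟨n', hn'⟩ := exists_int_lineIndex_mul_petersson_eq (ramanujanStableLattice N) f hs'
    rw [← hsw, peterssonProduct_add_right, peterssonProduct_smul_right, mul_add, mul_left_comm, hrdef, hn, hn']
    refine Λ.add_mem ?_ ?_
    · simpa [zsmul_eq_mul] using Λ.zsmul_mem hc_mem n
    · have : zeta3 * (n' * c) = n' • (zeta3 * c) := by rw [zsmul_eq_mul]; ring
      rw [this]
      exact Λ.zsmul_mem hζc_mem n'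
  have hΛΛr : Λ ≤ Λr := hΛA.trans hAΛr
  -- `[Λ_r : Λ] ∣ r²` via `(ℤ/r)² ↠ Λ_r / Λ`
  have hr0C : (r : ℂ) ≠ 0 := by exact_mod_cast hrpos.ne'
  have hg₁ : c / r ∈ Λr := by
    rw [AddSubgroup.mem_comap, AddMonoidHom.coe_mulLeft, mul_div_cancel₀ _ hr0C]; exact hc_mem
  have hg₂ : zeta3 * c / r ∈ Λr := by
    rw [AddSubgroup.mem_comap, AddMonoidHom.coe_mulLeft, mul_div_cancel₀ _ hr0C]; exact hζc_mem
  have hidx : Λ.relIndex Λr ∣ r ^ 2 := by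
    let Q := Λr ⧸ Λ.addSubgroupOf Λr
    let ψ : ℤ × ℤ →+ Q :=
      (QuotientAddGroup.mk' _).comp
        (((zmultiplesHom Λr) ⟨c / r, hg₁⟩).coprod ((zmultiplesHom Λr) ⟨zeta3 * c / r, hg₂⟩))
    have hψ : ∀ i j : ℤ, ψ (i, j) = QuotientAddGroup.mk (i • (⟨c / r, hg₁⟩ : Λr) + j • ⟨zeta3 * c / r, hg₂⟩) :=
      fun i j => rfl
    -- `ψ` kills `rℤ × rℤ`
    have hkill : ∀ i j : ℤ, ψ ((r : ℤ) * i, (r : ℤ) * j) = 0 := by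
      intro i j
      rw [hψ, QuotientAddGroup.eq_zero_iff, AddSubgroup.mem_addSubgroupOf]
      change ((r : ℤ) * i) • (c / r) + ((r : ℤ) * j) • (zeta3 * c / r) ∈ Λ
      have e : ((r : ℤ) * i) • (c / r) + ((r : ℤ) * j) • (zeta3 * c / r) = i • c + j • (zeta3 * c) := by
        simp only [zsmul_eq_mul]; push_cast; field_simp
      rw [e]
      exact Λ.add_mem (Λ.zsmul_mem hc_mem i) (Λ.zsmul_mem hζc_mem j)
    -- factor through `(ℤ/r)²`
    let π : ℤ × ℤ →+ ZMod r × ZMod r := (Int.castAddHom (ZMod r)).prodMap (Int.castAddHom (ZMod r))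
    have hπ : Function.Surjective π := fun ⟨a, b⟩ => by
      obtain ⟨i, rfl⟩ := ZMod.intCast_surjective a
      obtain ⟨j, rfl⟩ := ZMod.intCast_surjective b
      exact ⟨(i, j), rfl⟩
    have hker : π.ker ≤ ψ.ker := by
      rintro ⟨i, j⟩ hij
      rw [AddMonoidHom.mem_ker] at hij ⊢
      have hi : ((i : ℤ) : ZMod r) = 0 := congrArg Prod.fst hij
      have hj : ((j : ℤ) : ZMod r) = 0 := congrArg Prod.snd hij
      obtain ⟨i', rfl⟩ := (ZMod.intCast_zmod_eq_zero_iff_dvd i r).mp hi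
      obtain ⟨j', rfl⟩ := (ZMod.intCast_zmod_eq_zero_iff_dvd j r).mp hj
      exact hkill i' j'
    let ψ' : ZMod r × ZMod r →+ Q := AddMonoidHom.liftOfRightInverse π (Function.surjInv hπ)
      (Function.rightInverse_surjInv hπ) ⟨ψ, hker⟩
    have hψ' : ∀ x, ψ' (π x) = ψ x := fun x =>
      AddMonoidHom.liftOfRightInverse_comp_apply π _ _ ⟨ψ, hker⟩ x
    have hsurj : Function.Surjective ψ' := by
      rintro ⟨x⟩
      have hx : (r : ℂ) * (x : ℂ) ∈ Λ := x.2
      obtain ⟨i, j, hij⟩ := AddSubgroup.mem_closure_pair.mp hx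
      refine ⟨π (i, j), ?_⟩
      rw [hψ', hψ]
      change QuotientAddGroup.mk _ = QuotientAddGroup.mk x
      congr 1
      apply Subtype.ext
      change i • (c / r) + j • (zeta3 * c / r) = (x : ℂ)
      have e : (x : ℂ) = ((r : ℂ) * x) / r := by rw [mul_div_cancel_left₀ _ hr0C]
      rw [e, ← hij]
      simp only [zsmul_eq_mul]
      field_simp
    have hcard := AddSubgroup.card_dvd_of_surjective ψ' hsurj
    rw [Nat.card_prod, Nat.card_zmod, ← sq] at hcard
    rw [AddSubgroup.relIndex, AddSubgroup.index_eq_card]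
    exact hcard
  -- the chain `Λ ≤ A ≤ Λ_r`
  have hchain := AddSubgroup.relIndex_mul_relIndex Λ A Λr hΛA hAΛr
  rw [hplane]
  exact (Dvd.intro _ hchain).trans hidx

/-- **The UPPER HALF of E-desc-56 for `f ∈ M^G` with finite Ramanujan index**: `k(f) ≤ 2 · ord₃ r_R(f)`. -/
theorem eisensteinDepth_conwayNorton_le (h9 : 9 ∣ N) {f : CuspForm (Gamma0 N) 2}
    (hfM : f ∈ conwayNortonLatticeAtThree N) (hr : lineIndex (ramanujanStableLattice N) f ≠ 0) :
    eisensteinDepth (conwayNortonLatticeAtThree N) f ≤ 2 * padicValNat 3 (lineIndex (ramanujanStableLattice N) f) := by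
  haveI : Fact (Nat.Prime 3) := ⟨Nat.prime_three⟩
  have hd := planeIndex_conwayNorton_dvd_sq_lineIndex_ramanujan h9 hfM
  have hsq : lineIndex (ramanujanStableLattice N) f ^ 2 ≠ 0 := pow_ne_zero 2 hr
  unfold eisensteinDepth
  calc padicValNat 3 (planeIndex (conwayNortonLatticeAtThree N) f)
      ≤ padicValNat 3 (lineIndex (ramanujanStableLattice N) f ^ 2) :=
        (padicValNat_dvd_iff_le hsq).mp (pow_padicValNat_dvd.trans hd)
    _ = 2 * padicValNat 3 (lineIndex (ramanujanStableLattice N) f) := padicValNat.pow _ 2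

/-- **E-facing instance: same-conductor `(−3)`-twist pairs of elliptic curves.**  For data `D, D′` of `W, W′` at a common
level `9 ∣ N` with `9 ∣ N_{W′}` and `W ⊗ (−3) ∼ W′`, and finite Ramanujan index of `D.f`:
`k(D.f) ≤ 2 · ord₃ r_R(D.f)` (and `planeIndex(M^G, D.f) ∣ r_R(D.f)²`). -/
theorem eisensteinDepth_le_of_isIsogenous_quadraticTwist_negThree {W W' : WeierstrassCurve ℚ} [W.IsElliptic]
    [W'.IsElliptic] (D : ModularParametrizationData W N) (D' : ModularParametrizationData W' N) (h9 : 9 ∣ N)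
    (h9W' : 9 ∣ W'.conductorNorm ℤ) (hiso : IsIsogenous (W.quadraticTwist ((-3 : ℤ) : ℚ)) W')
    (hr : lineIndex (ramanujanStableLattice N) D.f ≠ 0) :
    planeIndex (conwayNortonLatticeAtThree N) D.f ∣ (lineIndex (ramanujanStableLattice N) D.f) ^ 2 ∧
    eisensteinDepth (conwayNortonLatticeAtThree N) D.f ≤
      2 * padicValNat 3 (lineIndex (ramanujanStableLattice N) D.f) := by
  have h9' : 3 ^ 2 ∣ N := by simpa using h9
  have hfM := (mem_conwayNorton_of_isIsogenous_quadraticTwist_negThree D D' h9' h9W' hiso).1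
  exact ⟨planeIndex_conwayNorton_dvd_sq_lineIndex_ramanujan h9 hfM, eisensteinDepth_conwayNorton_le h9 hfM hr⟩

end Summit.BirchSwinnertonDyer.BirchSwinnertonDyer.Theorems.ManinLocalTwoThree

end
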